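import Summits.BirchSwinnertonDyer.BirchSwinnertonDyer.Theorems.PrintX11aLowerHalfMuAnBranchDictionary
import HarnessLib

/-!
# Crux `X11aLowerHalf` (item stmt-BirchSwinnertonDyer-19064), registered stub `stub_muAnSurjDeepFive` — part 2 of 2: the winding theorem
# in BRANCH currency on class X11a — `MultTeichOrbitUnitAt ⟺ μ(L⁺_p(·, ω⁰)) = 0`, SOME EVEN branch has `μ = 0`, the dichotomy
# `ω⁰ ∨ ω²` at `p = 5` and the trichotomy `ω⁰ ∨ ω² ∨ ω⁴` at `p = 7`

Cell `bsd-print-x11a`, width seat bsd-line-x11a-p1-w6 («width 6»; `--supports stmt-BirchSwinnertonDyer-19064`, helper; the item named by -w2 g4's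
HANDOFF «Successor (b): the `p = 5` branch dichotomy»).  THEOREMS ONLY (no definition, no named fact, no `sorry`).  The registered stub
`stub_muAnSurjDeepFive : ∀ W p, ClassX11a W p → 5 ≤ p → Surj W p → ¬ X11a.ShaAnUnit W p → X11a.MuAnZeroAt W p` (Greenberg LNM 1716 Conj. 1.11,
analytic `ω⁰` branch, deep surjective X11a pairs) stays OPEN class-wide; this file says, in the `μ`-currency of the stub, exactly how far the
tree's winding theorem at a multiplicative prime (`MultWinding.exists_one_le_norm_ratPlusSymbol_div_prime_pow`, -w2 g3, p625392: a unit plus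
symbol `[u/pᵏ]⁺_f`, `k ≥ 1`, `p ∤ u`, for every newform of `E` multiplicative at an odd `p` with `E[p]` irreducible) goes:

* `oneTerm_package_of_mult` — for the newform `f` of `E = W`, `E` multiplicative at an odd `p`, `E[p]` irreducible, `a_p(f) = ap`: `‖ap‖_p = 1`,
  the distribution law of `μ⁺_{f,ap}` (`sum_fiber_msdPlusMeasureMult_succ_eq_of_coeffField`) and `p`-integrality of every `[a/pᵐ]⁺_f`
  (`IsNewformOf.norm_ratPlusSymbol_val_div_le_max_of_multiplicative` + the Eisenstein multiple from irreducibility) — fact-free.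
* `norm_coeff_branch_zero_iff_teichOrbitSum_of_mult`, `multTeichOrbitUnitAt_iff_forall_branch_zero` — THE DICTIONARY: U5's S3 input
  `MultTeich.MultTeichOrbitUnitAt W p` (unit Teichmüller orbit sums for every newform) ⟺ `μ(L⁺_p(f, a_p, ω⁰)) = 0` for every newform `f` of `W`.
* `exists_even_branch_norm_coeff_eq_one_of_mult` ∕ `ClassX11a.exists_even_branch_norm_coeff_eq_one` — **SOME EVEN branch `ω^i`, `i < p − 1`,
  of `L⁺_p(f, a_p)` has `μ = 0`** at every multiplicative odd `p` with `E[p]` irreducible, in particular at EVERY X11a pair — the multiplicative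
  twin of bsd-f3-mu's `EvenBranch.evenBranchMuZero` (good ordinary, `Theorems/PrintX9EvenBranchMuZeroInputFree.lean`).
* `branchZero_or_exists_even_pos_branch_of_mult`, `branchZero_or_branchTwo_five_of_mult`, `branchZero_or_branchTwo_or_branchFour_seven_of_mult` —
  per newform: `μ(ω⁰) = 0 ∨ μ(ω^i) = 0` for some even `0 < i < p − 1`; at `p = 5`: **`μ(L⁺_5(f, a_5, ω⁰)) = 0 ∨ μ(L⁺_5(f, a_5, ω²)) = 0`** (`ω²` =
  the quadratic character `(5/·)`: the branch whose special values are those of the twist `E ⊗ (5/·)`, additive of type `I_n^*` at `5`, up to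
  the ratio of real periods); at `p = 7` the trichotomy.  Twins of `EvenBranch.muAnZero_or_branchTwo_five` ∕ `…_or_branchFour_seven`.
* `multTeichOrbitUnitAt_or_exists_even_pos_branch`, `muAnZeroAt_or_exists_even_pos_branch`, `muAnZeroAt_or_exists_branchTwo_five`,
  `muAnSurjDeepFive_or_residual` — pair level: EITHER `MultTeichOrbitUnitAt W p` (hence the crux's `X11a.MuAnZeroAt W p` by U5's S3
  `MultTeich.multMuAnAt_of_orbitUnitAt` + `X11aLowerHalfEvenBranch.muAnZeroAt_of_multMuAnAt`, modulo the two displayed facts Mazur 1978 Cor. 4.1 ∕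
  Wuthrich 2014 Cor. 18 — the latter carried, unused) OR some newform of `W` has NO unit `ω⁰` orbit sum and a NON-TRIVIAL even branch with
  `μ = 0` — the residual of `stub_muAnSurjDeepFive` at that pair in `μ`-currency (§5 of `PrintX11aLowerHalfMuAnEvenBranch`, whose second alternative
  was «two incongruent symbols on an orbit», upgraded).

HONEST SCOPE: at `p = 3` the even characters of `(ℤ/3)ˣ` reduce to `ω⁰` and the statement is x11a-p2 g2's theorem; at `p ≥ 5` the competitor
branches `ω²`, … are genuine and nothing here separates them from `ω⁰`: `stub_muAnSurjDeepFive` stays OPEN, crux L stays OPEN; closes nothing;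
beyond-print theorem: no (MTT §I.13 bookkeeping on top of the beyond-print winding theorem); PARTITION 0.  BSD is not proved by any of this.
References: [MazurTateTeitelbaum1986Invent] §I.10 (10.1), §I.13; [GreenbergLNM1716] Conj. 1.11 (p. 61); [Mazur1978] Cor. 4.1;
[GreenbergVatsal2000] §3 Prop. (3.7); [Washington1997] §5.1, §7.2.
-/

set_option linter.dupNamespace false
set_option autoImplicit false

noncomputable section

open scoped MatrixGroups ModularForm
open Filter Topology
open CongruenceSubgroup WeierstrassCurve
  Literature.NumberTheory.EllipticCurves Literature.NumberTheory.EllipticCurves.ModularForms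
  Literature.NumberTheory.EllipticCurves.Rank1Residual
  Summit.BirchSwinnertonDyer.Rank1Residual
  Summit.BirchSwinnertonDyer.BirchSwinnertonDyer.Cruxes.UpperNonSurjFive.MultTeich
  Summit.BirchSwinnertonDyer.BirchSwinnertonDyer.Cruxes.AnalyticMuZeroX9.TeichSpan

namespace Summit.BirchSwinnertonDyer.BirchSwinnertonDyer.Theorems.X11aLowerHalfBranch

/-! ### §2 Elliptic curves at a MULTIPLICATIVE odd prime with `E[p]` irreducible (fact-free) -/

section Curve

variable {p : ℕ} [Fact p.Prime] {W : WeierstrassCurve ℚ} [W.IsElliptic] [W.IsGloballyMinimal]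
  {N : ℕ} [NeZero N] {f : CuspForm (Gamma0 N) 2}

/-- **The one-term package at a multiplicative odd prime with `E[p]` irreducible** (fact-free): for the newform `f` of `E = W` and
`a_p(f) = ap` — `ap = ±1` so `‖ap‖_p = 1` (`IsNewformOf.dvd_level_and_not_sq_dvd_of_multiplicative`); the distribution law of
`μ⁺_{f,ap}` (`sum_fiber_msdPlusMeasureMult_succ_eq_of_coeffField`, the `U_p`-relation); `p`-integrality of every `[a/pᵐ]⁺_f`
(`IsNewformOf.norm_ratPlusSymbol_val_div_le_max_of_multiplicative`, and `‖[0]⁺_f‖_p ≤ 1` from the Eisenstein multiple `n₀{∞,0} ∈ Λ_f`, `p ∤ n₀`,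
that irreducibility provides: `exists_intCast_mul_modularSymbol_zero_mem`, `norm_ratPlusSymbol_le_one`). [cite: MazurTateTeitelbaum1986Invent, §I.10 (10.1)–(10.2)]
[cite: GreenbergVatsal2000, §3 Rem. 3.4] -/
theorem oneTerm_package_of_mult (hp2 : p ≠ 2)
    (hmult : W.HasMultiplicativeReductionAtPrime p) (hirr : W.HasIrreducibleModPGaloisRep p)
    (hf : IsNewformOf W f) {ap : ℤ} (hap : cuspCoeff f p = ap) :
    ‖((ap : ℚ_[p]))‖ = 1 ∧
      (∀ (n : ℕ) (a : ZMod (p ^ n)),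
        ∑ b ∈ Finset.univ.filter (fun b : ZMod (p ^ (n + 1)) ↦
          ZMod.castHom (pow_dvd_pow p n.le_succ) (ZMod (p ^ n)) b = a), msdPlusMeasureMult f (ap : ℚ_[p]) (n + 1) b =
          msdPlusMeasureMult f (ap : ℚ_[p]) n a) ∧
      ∀ (m : ℕ) (b : ZMod (p ^ m)), ‖((ratPlusSymbol f ((b.val : ℚ) / (p : ℚ) ^ m) : ℚ) : ℚ_[p])‖ ≤ 1 := by
  have hQ : coeffField f = ⊥ := hf.coeffField_eq_bot
  obtain ⟨hpN, -, ap', hap', hap1⟩ := hf.dvd_level_and_not_sq_dvd_of_multiplicative hmult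
  have hapeq : ap' = ap := by
    have h := hap'.symm.trans hap
    exact_mod_cast h
  subst hapeq
  have hα1 : ‖((ap' : ℚ_[p]))‖ = 1 := by
    rcases hap1 with h | h <;> simp [h]
  have hap0 : (ap' : ℚ_[p]) ≠ 0 := by
    intro h
    rw [h, norm_zero] at hα1
    exact zero_ne_one hα1
  obtain ⟨n₀, hpn₀, h0Λ⟩ :=
    exists_intCast_mul_modularSymbol_zero_mem not_irreducible_of_frobeniusTrace_congr_holds hf hirr
  have h00 : ‖((ratPlusSymbol f 0 : ℚ) : ℚ_[p])‖ ≤ 1 :=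
    norm_ratPlusSymbol_le_one f hp2 hpn₀ h0Λ (by rw [Rat.den_zero]; exact Nat.coprime_one_left N)
  exact ⟨hα1, sum_fiber_msdPlusMeasureMult_succ_eq_of_coeffField hf.1 hQ hpN hap' hap0, fun m b ↦
    (hf.norm_ratPlusSymbol_val_div_le_max_of_multiplicative hp2 hmult m b).trans (max_le le_rfl h00)⟩

/-- **THE `ω⁰` DICTIONARY for the newform of `E` at a multiplicative odd prime with `E[p]` irreducible**:
`μ(L⁺_p(f, a_p, ω⁰)) = 0` (some coefficient of `padicLFunctionPlusBranchMult f a_p 0` is a `p`-adic unit) **iff** some Teichmüller orbit sum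
`A_n(a) = Σ_{t^{p−1}=1}[ta/pⁿ]⁺_f`, `n ≥ 1`, `a` a unit, is a `p`-adic unit (the clause of `MultTeich.MultTeichOrbitUnitAt W p` at `f`).  Part 1's two
directions fed the package. [cite: MazurTateTeitelbaum1986Invent, §I.11–I.13] [cite: GreenbergVatsal2000, §3 (2)–(3)] -/
theorem norm_coeff_branch_zero_iff_teichOrbitSum_of_mult (hp2 : p ≠ 2)
    (hmult : W.HasMultiplicativeReductionAtPrime p) (hirr : W.HasIrreducibleModPGaloisRep p)
    (hf : IsNewformOf W f) {ap : ℤ} (hap : cuspCoeff f p = ap) :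
    (∃ k : ℕ, ‖PowerSeries.coeff k (padicLFunctionPlusBranchMult f (ap : ℚ_[p]) 0)‖ = 1) ↔
      ∃ n : ℕ, 1 ≤ n ∧ ∃ a : (ZMod (p ^ n))ˣ, 1 ≤ ‖((teichOrbitSum f p n (a : ZMod (p ^ n)) : ℚ) : ℚ_[p])‖ := by
  obtain ⟨hα1, hdist, hint⟩ := oneTerm_package_of_mult hp2 hmult hirr hf hap
  constructor
  · rintro ⟨k, hk⟩
    exact exists_teichOrbitSum_unit_of_norm_coeff_branch_zero hp2 hα1 hdist hint hk.ge
  · rintro ⟨n₁, hn₁, a, ha⟩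
    have he : cyclotomicExponent p = 1 := if_neg hp2
    obtain ⟨n, rfl⟩ : ∃ n, n₁ = n + cyclotomicExponent p := ⟨n₁ - 1, by rw [he]; omega⟩
    obtain ⟨k, -, hk⟩ := exists_norm_coeff_branch_zero_eq_one_of_teichOrbitSum hp2 hα1 hdist hint n a ha
    exact ⟨k, hk⟩

/-- **Pair level: U5's S3 input `MultTeichOrbitUnitAt W p` ⟺ `μ(L⁺_p(f, a_p, ω⁰)) = 0` for EVERY newform `f` of `W`** (multiplicative odd
`p`, `E[p]` irreducible). [cite: MazurTateTeitelbaum1986Invent, §I.11–I.13] [cite: GreenbergLNM1716, Conj. 1.11 (p. 61)] -/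
theorem multTeichOrbitUnitAt_iff_forall_branch_zero (hp2 : p ≠ 2)
    (hmult : W.HasMultiplicativeReductionAtPrime p) (hirr : W.HasIrreducibleModPGaloisRep p) :
    MultTeichOrbitUnitAt W p ↔
      ∀ {N : ℕ} [NeZero N] (f : CuspForm (Gamma0 N) 2), IsNewformOf W f → ∀ ap : ℤ, cuspCoeff f p = ap →
        ∃ k : ℕ, ‖PowerSeries.coeff k (padicLFunctionPlusBranchMult f (ap : ℚ_[p]) 0)‖ = 1 := by
  constructor
  · intro h N _ f hf ap hap
    exact (norm_coeff_branch_zero_iff_teichOrbitSum_of_mult hp2 hmult hirr hf hap).mpr (h f hf)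
  · intro h N _ f hf
    obtain ⟨-, -, ap, hap, -⟩ := hf.dvd_level_and_not_sq_dvd_of_multiplicative hmult
    exact (norm_coeff_branch_zero_iff_teichOrbitSum_of_mult hp2 hmult hirr hf hap).mp (h f hf ap hap)

/-- **The winding theorem in branch currency, with the `ω⁰` clause.**  `E = W/ℚ` multiplicative at an ODD `p`, `E[p]` irreducible, `f` a
newform of `E`, `a_p(f) = ap`: there are a unit `u ∈ (ℤ/p^{n+e₀})ˣ` and an EVEN `i < p − 1` such that `L⁺_p(f, ap, ω^i, T)` has a coefficient of
norm `1`, where `i = 0` only if `A(u)` is a unit.  = the unit symbol of `MultWinding.exists_one_le_norm_ratPlusSymbol_div_prime_pow` fed, with the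
package, to part 1's `exists_even_branch_norm_coeff_eq_one_of_unit_symbol`. [cite: MazurTateTeitelbaum1986Invent, §I.10 (10.1), §I.13]
[cite: GreenbergLNM1716, Conj. 1.11 (p. 61)] -/
theorem exists_unit_and_even_branch_of_mult (hp2 : p ≠ 2)
    (hmult : W.HasMultiplicativeReductionAtPrime p) (hirr : W.HasIrreducibleModPGaloisRep p)
    (hf : IsNewformOf W f) {ap : ℤ} (hap : cuspCoeff f p = ap) :
    ∃ (n : ℕ) (u : (ZMod (p ^ (n + cyclotomicExponent p)))ˣ), ∃ i < p - 1, Even i ∧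
      (i = 0 → 1 ≤ ‖((teichOrbitSum f p (n + cyclotomicExponent p)
        (u : ZMod (p ^ (n + cyclotomicExponent p))) : ℚ) : ℚ_[p])‖) ∧
      ∃ k : ℕ, ‖PowerSeries.coeff k (padicLFunctionPlusBranchMult f (ap : ℚ_[p]) i)‖ = 1 := by
  classical
  have hp : p.Prime := Fact.out
  obtain ⟨hα1, hdist, hint⟩ := oneTerm_package_of_mult hp2 hmult hirr hf hap
  -- the unit symbol of the winding theorem, at a level of the form `n + e₀`
  obtain ⟨k, u, hk, hu, hunit⟩ :=
    MultWinding.exists_one_le_norm_ratPlusSymbol_div_prime_pow W p hp2 hmult hirr hf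
  have he : cyclotomicExponent p = 1 := if_neg hp2
  obtain ⟨n, rfl⟩ : ∃ n, k = n + cyclotomicExponent p := ⟨k - 1, by rw [he]; omega⟩
  haveI : NeZero (p ^ (n + cyclotomicExponent p)) := ⟨pow_ne_zero _ hp.ne_zero⟩
  have hpprime : Prime (p : ℤ) := Nat.prime_iff_prime_int.mp hp
  have hcop : IsCoprime ((p ^ (n + cyclotomicExponent p) : ℕ) : ℤ) u := by
    have h1 : IsCoprime (p : ℤ) u := (Irreducible.coprime_iff_not_dvd hpprime.irreducible).mpr hu
    simpa using h1.pow_left (m := n + cyclotomicExponent p)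
  have hua : IsUnit ((u : ℤ) : ZMod (p ^ (n + cyclotomicExponent p))) :=
    (ZMod.coe_int_isUnit_iff_isCoprime u (p ^ (n + cyclotomicExponent p))).mpr hcop
  have hsym : ratPlusSymbol f ((u : ℚ) / (p : ℚ) ^ (n + cyclotomicExponent p)) =
      ratPlusSymbol f ((((hua.unit : ZMod (p ^ (n + cyclotomicExponent p)))).val : ℚ) /
        (p : ℚ) ^ (n + cyclotomicExponent p)) := by
    rw [hua.unit_spec]
    exact ratPlusSymbol_intCast_div_pow (f := f) (p := p) (n + cyclotomicExponent p) u
  rw [hsym] at hunit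
  exact ⟨n, hua.unit, exists_even_branch_norm_coeff_eq_one_of_unit_symbol hp2 hα1 hdist hint n hua.unit hunit⟩

/-- **SOME EVEN tame branch of `L_p(E)` has `μ = 0` at a multiplicative odd prime with `E[p]` irreducible**: for every newform `f` of `E` and
`a_p(f) = ap`, some even `i < p − 1` and some `k` have `‖[Tᵏ] L⁺_p(f, ap, ω^i, T)‖_p = 1`.  NOT the `ω⁰` statement for `p ≥ 5`.
[cite: MazurTateTeitelbaum1986Invent, §I.13] [cite: GreenbergLNM1716, Conj. 1.11 (p. 61)] -/
theorem exists_even_branch_norm_coeff_eq_one_of_mult (hp2 : p ≠ 2)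
    (hmult : W.HasMultiplicativeReductionAtPrime p) (hirr : W.HasIrreducibleModPGaloisRep p)
    (hf : IsNewformOf W f) {ap : ℤ} (hap : cuspCoeff f p = ap) :
    ∃ i < p - 1, Even i ∧ ∃ k : ℕ, ‖PowerSeries.coeff k (padicLFunctionPlusBranchMult f (ap : ℚ_[p]) i)‖ = 1 := by
  obtain ⟨-, -, i, hi, hieven, -, k, hk⟩ := exists_unit_and_even_branch_of_mult hp2 hmult hirr hf hap
  exact ⟨i, hi, hieven, k, hk⟩

/-- **The ORBIT ∕ BRANCH DICHOTOMY** (per newform): EITHER a unit Teichmüller orbit sum `A_n(a)`, `n ≥ 1` (the `ω⁰` certificate) OR some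
NON-TRIVIAL even branch `ω^i`, `0 < i < p − 1`, of `L⁺_p(f, a_p)` has `μ = 0`. [cite: MazurTateTeitelbaum1986Invent, §I.10 (10.1), §I.13]
[cite: GreenbergLNM1716, Conj. 1.11 (p. 61)] -/
theorem teichOrbitUnit_or_exists_even_pos_branch_of_mult (hp2 : p ≠ 2)
    (hmult : W.HasMultiplicativeReductionAtPrime p) (hirr : W.HasIrreducibleModPGaloisRep p)
    (hf : IsNewformOf W f) {ap : ℤ} (hap : cuspCoeff f p = ap) :
    (∃ n : ℕ, 1 ≤ n ∧ ∃ a : (ZMod (p ^ n))ˣ, 1 ≤ ‖((teichOrbitSum f p n (a : ZMod (p ^ n)) : ℚ) : ℚ_[p])‖) ∨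
      ∃ i : ℕ, 0 < i ∧ i < p - 1 ∧ Even i ∧
        ∃ k : ℕ, ‖PowerSeries.coeff k (padicLFunctionPlusBranchMult f (ap : ℚ_[p]) i)‖ = 1 := by
  obtain ⟨n, u, i, hi, hieven, h0, k, hk⟩ := exists_unit_and_even_branch_of_mult hp2 hmult hirr hf hap
  by_cases hi0 : i = 0
  · have he : 1 ≤ n + cyclotomicExponent p := by
      have := Nat.pos_of_ne_zero (cyclotomicExponent_ne_zero p); omega
    exact Or.inl ⟨n + cyclotomicExponent p, he, u, h0 hi0⟩
  · exact Or.inr ⟨i, Nat.pos_of_ne_zero hi0, hi, hieven, k, hk⟩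

/-- **The BRANCH DICHOTOMY** (per newform, pure `μ`-currency): `μ(L⁺_p(f, a_p, ω⁰)) = 0` OR `μ(L⁺_p(f, a_p, ω^i)) = 0` for some even
`0 < i < p − 1`. [cite: MazurTateTeitelbaum1986Invent, §I.13] [cite: GreenbergLNM1716, Conj. 1.11 (p. 61)] -/
theorem branchZero_or_exists_even_pos_branch_of_mult (hp2 : p ≠ 2)
    (hmult : W.HasMultiplicativeReductionAtPrime p) (hirr : W.HasIrreducibleModPGaloisRep p)
    (hf : IsNewformOf W f) {ap : ℤ} (hap : cuspCoeff f p = ap) :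
    (∃ k : ℕ, ‖PowerSeries.coeff k (padicLFunctionPlusBranchMult f (ap : ℚ_[p]) 0)‖ = 1) ∨
      ∃ i : ℕ, 0 < i ∧ i < p - 1 ∧ Even i ∧
        ∃ k : ℕ, ‖PowerSeries.coeff k (padicLFunctionPlusBranchMult f (ap : ℚ_[p]) i)‖ = 1 := by
  rcases teichOrbitUnit_or_exists_even_pos_branch_of_mult hp2 hmult hirr hf hap with h | h
  · exact Or.inl ((norm_coeff_branch_zero_iff_teichOrbitSum_of_mult hp2 hmult hirr hf hap).mpr h)
  · exact Or.inr h

/-- **`p = 5`: `μ(L⁺_5(f, a_5, ω⁰)) = 0 ∨ μ(L⁺_5(f, a_5, ω²)) = 0`** for `E = W/ℚ` multiplicative at `5` with `E[5]` irreducible and any newform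
`f` of `E` (`0 < i < 4` even forces `i = 2`; `ω² = (5/·)`).  The multiplicative twin of `EvenBranch.muAnZero_or_branchTwo_five`.
[cite: MazurTateTeitelbaum1986Invent, §I.13] [cite: GreenbergLNM1716, Conj. 1.11 (p. 61)] -/
theorem branchZero_or_branchTwo_five_of_mult [Fact (5 : ℕ).Prime]
    (hmult : W.HasMultiplicativeReductionAtPrime 5) (hirr : W.HasIrreducibleModPGaloisRep 5)
    (hf : IsNewformOf W f) {ap : ℤ} (hap : cuspCoeff f 5 = ap) :
    (∃ k : ℕ, ‖PowerSeries.coeff k (padicLFunctionPlusBranchMult f (ap : ℚ_[5]) 0)‖ = 1) ∨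
      ∃ k : ℕ, ‖PowerSeries.coeff k (padicLFunctionPlusBranchMult f (ap : ℚ_[5]) 2)‖ = 1 := by
  rcases branchZero_or_exists_even_pos_branch_of_mult (p := 5) (by decide) hmult hirr hf hap with
    h | ⟨i, hi0, hi, hieven, hk⟩
  · exact Or.inl h
  · obtain rfl : i = 2 := by
      obtain ⟨j, rfl⟩ := hieven
      omega
    exact Or.inr hk

/-- **`p = 7`: `μ(ω⁰) = 0 ∨ μ(ω²) = 0 ∨ μ(ω⁴) = 0`** for `L⁺_7(f, a_7, ·)`, `E` multiplicative at `7` with `E[7]` irreducible.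
[cite: MazurTateTeitelbaum1986Invent, §I.13] [cite: GreenbergLNM1716, Conj. 1.11 (p. 61)] -/
theorem branchZero_or_branchTwo_or_branchFour_seven_of_mult [Fact (7 : ℕ).Prime]
    (hmult : W.HasMultiplicativeReductionAtPrime 7) (hirr : W.HasIrreducibleModPGaloisRep 7)
    (hf : IsNewformOf W f) {ap : ℤ} (hap : cuspCoeff f 7 = ap) :
    (∃ k : ℕ, ‖PowerSeries.coeff k (padicLFunctionPlusBranchMult f (ap : ℚ_[7]) 0)‖ = 1) ∨
      (∃ k : ℕ, ‖PowerSeries.coeff k (padicLFunctionPlusBranchMult f (ap : ℚ_[7]) 2)‖ = 1) ∨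
      ∃ k : ℕ, ‖PowerSeries.coeff k (padicLFunctionPlusBranchMult f (ap : ℚ_[7]) 4)‖ = 1 := by
  rcases branchZero_or_exists_even_pos_branch_of_mult (p := 7) (by decide) hmult hirr hf hap with
    h | ⟨i, hi0, hi, hieven, hk⟩
  · exact Or.inl h
  · have hi' : i = 2 ∨ i = 4 := by
      obtain ⟨j, rfl⟩ := hieven
      omega
    rcases hi' with rfl | rfl
    · exact Or.inr (Or.inl hk)
    · exact Or.inr (Or.inr hk)

end Curve

/-! ### §3 Class X11a: the pair-level reading, and the `μ`-reading modulo the two displayed facts of U5's S3 -/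

section ClassX11a

variable {p : ℕ} [Fact p.Prime] {W : WeierstrassCurve ℚ} [W.IsElliptic] [W.IsGloballyMinimal]

/-- **Some even branch has `μ = 0` at EVERY X11a pair** (any odd `p`, unit or deep, surjective or not): for every newform `f` of `W` and
`a_p(f) = ap`, some even `i < p − 1` and some `k` have `‖[Tᵏ] L⁺_p(f, ap, ω^i, T)‖_p = 1`.  `ClassX11a` supplies `p ≠ 2`, multiplicative
reduction and irreducibility; the rank and (ram) clauses are not used. [cite: GreenbergLNM1716, Conj. 1.11 (p. 61)]
[cite: MazurTateTeitelbaum1986Invent, §I.13] -/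
theorem _root_.Summit.BirchSwinnertonDyer.Rank1Residual.ClassX11a.exists_even_branch_norm_coeff_eq_one
    (hX : ClassX11a W p) {N : ℕ} [NeZero N] {f : CuspForm (Gamma0 N) 2} (hf : IsNewformOf W f) {ap : ℤ}
    (hap : cuspCoeff f p = ap) :
    ∃ i < p - 1, Even i ∧ ∃ k : ℕ, ‖PowerSeries.coeff k (padicLFunctionPlusBranchMult f (ap : ℚ_[p]) i)‖ = 1 :=
  exists_even_branch_norm_coeff_eq_one_of_mult hX.2.1 hX.2.2.1 hX.2.2.2.1 hf hap

/-- **The pair-level dichotomy** (multiplicative odd `p`, `E[p]` irreducible): EITHER `MultTeich.MultTeichOrbitUnitAt W p` (unit orbit sums for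
every newform — U5's S3 input, `= μ(L⁺_p(·, ω⁰)) = 0` for every newform by `multTeichOrbitUnitAt_iff_forall_branch_zero`), OR some newform `f`
of `W` has NO unit `ω⁰` orbit sum at any level and yet a NON-TRIVIAL even branch `ω^i` (`0 < i < p − 1`) with `μ = 0` — the honest residual of
`stub_muAnSurjDeepFive` at that pair. [cite: MazurTateTeitelbaum1986Invent, §I.10 (10.1), §I.13] [cite: GreenbergLNM1716, Conj. 1.11 (p. 61)] -/
theorem multTeichOrbitUnitAt_or_exists_even_pos_branch (hp2 : p ≠ 2)
    (hmult : W.HasMultiplicativeReductionAtPrime p) (hirr : W.HasIrreducibleModPGaloisRep p) :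
    MultTeichOrbitUnitAt W p ∨
      ∃ (N : ℕ) (_ : NeZero N) (f : CuspForm (Gamma0 N) 2) (ap : ℤ), IsNewformOf W f ∧ cuspCoeff f p = ap ∧
        (∀ n : ℕ, 1 ≤ n → ∀ a : (ZMod (p ^ n))ˣ, ‖((teichOrbitSum f p n (a : ZMod (p ^ n)) : ℚ) : ℚ_[p])‖ < 1) ∧
        ∃ i : ℕ, 0 < i ∧ i < p - 1 ∧ Even i ∧
          ∃ k : ℕ, ‖PowerSeries.coeff k (padicLFunctionPlusBranchMult f (ap : ℚ_[p]) i)‖ = 1 := by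
  by_cases h : MultTeichOrbitUnitAt W p
  · exact Or.inl h
  · right
    simp only [MultTeichOrbitUnitAt, not_forall, not_exists, not_and, not_le] at h
    obtain ⟨N, hN, f, hf, hsmall⟩ := h
    obtain ⟨-, -, ap, hap, -⟩ := hf.dvd_level_and_not_sq_dvd_of_multiplicative hmult
    refine ⟨N, hN, f, ap, hf, hap, fun n hn a ↦ hsmall n hn a, ?_⟩
    rcases teichOrbitUnit_or_exists_even_pos_branch_of_mult hp2 hmult hirr hf hap with ⟨n, hn, a, hbig⟩ | hres
    · exact absurd (hsmall n hn a) (not_lt.mpr hbig)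
    · exact hres

/-- **The `μ`-reading on class X11a, modulo the two displayed facts of S3** (Mazur 1978 Cor. 4.1 `‖ϖ‖_p = 1`; Wuthrich 2014 Cor. 18 carried by S3's
registered signature, unused): at every X11a pair, EITHER the crux's `X11a.MuAnZeroAt W p` (Greenberg's analytic `μ(L_p(E, ω⁰)) = 0`, via
`MultTeich.multMuAnAt_of_orbitUnitAt` and `X11aLowerHalfEvenBranch.muAnZeroAt_of_multMuAnAt`), OR some newform of `W` has no unit `ω⁰` orbit sum and a
non-trivial even branch with `μ = 0`.  CONDITIONAL display; closes nothing; at `p = 3` the second alternative is empty (`0 < i < 2` even).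
[cite: GreenbergLNM1716, Conj. 1.11 (p. 61)] [cite: Mazur1978, Cor. 4.1] [cite: MazurTateTeitelbaum1986Invent, §I.13] -/
theorem muAnZeroAt_or_exists_even_pos_branch (hMz : mazur_not_dvd_maninConstant_of_odd)
    (h18 : Wuthrich2014.corollary18_padicLFunction_mem_iwasawaAlgebra_multiplicative) (hX : ClassX11a W p) :
    X11a.MuAnZeroAt W p ∨
      ∃ (N : ℕ) (_ : NeZero N) (f : CuspForm (Gamma0 N) 2) (ap : ℤ), IsNewformOf W f ∧ cuspCoeff f p = ap ∧
        (∀ n : ℕ, 1 ≤ n → ∀ a : (ZMod (p ^ n))ˣ, ‖((teichOrbitSum f p n (a : ZMod (p ^ n)) : ℚ) : ℚ_[p])‖ < 1) ∧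
        ∃ i : ℕ, 0 < i ∧ i < p - 1 ∧ Even i ∧
          ∃ k : ℕ, ‖PowerSeries.coeff k (padicLFunctionPlusBranchMult f (ap : ℚ_[p]) i)‖ = 1 := by
  rcases multTeichOrbitUnitAt_or_exists_even_pos_branch hX.2.1 hX.2.2.1 hX.2.2.2.1 with horb | hres
  · exact Or.inl (X11aLowerHalfEvenBranch.muAnZeroAt_of_multMuAnAt
      (multMuAnAt_of_orbitUnitAt hMz h18 W p hX.2.1 hX.2.2.1 hX.2.2.2.1 horb))
  · exact Or.inr hres

/-- **`p = 5` on class X11a, modulo the same two facts: `μ(L_5(E, ω⁰)) = 0` ∨ (some newform `f` of `E` has `μ(L⁺_5(f, a_5, ω²)) = 0` and no unit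
`ω⁰` orbit sum)** — how far the tree goes toward `stub_muAnSurjDeepFive` at `p = 5`: the only competitor of `ω⁰` is `ω² = (5/·)`.
[cite: GreenbergLNM1716, Conj. 1.11 (p. 61)] [cite: Mazur1978, Cor. 4.1] [cite: MazurTateTeitelbaum1986Invent, §I.13] -/
theorem muAnZeroAt_or_exists_branchTwo_five [Fact (5 : ℕ).Prime] (hMz : mazur_not_dvd_maninConstant_of_odd)
    (h18 : Wuthrich2014.corollary18_padicLFunction_mem_iwasawaAlgebra_multiplicative) (hX : ClassX11a W 5) :
    X11a.MuAnZeroAt W 5 ∨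
      ∃ (N : ℕ) (_ : NeZero N) (f : CuspForm (Gamma0 N) 2) (ap : ℤ), IsNewformOf W f ∧ cuspCoeff f 5 = ap ∧
        (∀ n : ℕ, 1 ≤ n → ∀ a : (ZMod (5 ^ n))ˣ, ‖((teichOrbitSum f 5 n (a : ZMod (5 ^ n)) : ℚ) : ℚ_[5])‖ < 1) ∧
        ∃ k : ℕ, ‖PowerSeries.coeff k (padicLFunctionPlusBranchMult f (ap : ℚ_[5]) 2)‖ = 1 := by
  rcases muAnZeroAt_or_exists_even_pos_branch hMz h18 hX with
    h | ⟨N, hN, f, ap, hf, hap, hsmall, i, hi0, hi, hieven, hk⟩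
  · exact Or.inl h
  · obtain rfl : i = 2 := by
      obtain ⟨j, rfl⟩ := hieven
      omega
    exact Or.inr ⟨N, hN, f, ap, hf, hap, hsmall, hk⟩

/-- **The registered stub's binder block, split**: for every X11a pair at `p ≥ 5` (surjective, deep — clauses unused) the tree PROVES, modulo
Mazur Cor. 4.1 (+ Wuthrich Cor. 18 carried), «`X11a.MuAnZeroAt W p` (the stub's conclusion) ∨ the non-trivial-even-branch residual».
`stub_muAnSurjDeepFive` itself (the first disjunct alone) stays OPEN class-wide. [cite: GreenbergLNM1716, Conj. 1.11 (p. 61)] [cite: Mazur1978, Cor. 4.1] -/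
theorem muAnSurjDeepFive_or_residual (hMz : mazur_not_dvd_maninConstant_of_odd)
    (h18 : Wuthrich2014.corollary18_padicLFunction_mem_iwasawaAlgebra_multiplicative) :
    ∀ (W : WeierstrassCurve ℚ) [W.IsElliptic] [W.IsGloballyMinimal] (p : ℕ) [Fact p.Prime],
      ClassX11a W p → 5 ≤ p → Surj W p → ¬ X11a.ShaAnUnit W p →
        X11a.MuAnZeroAt W p ∨
          ∃ (N : ℕ) (_ : NeZero N) (f : CuspForm (Gamma0 N) 2) (ap : ℤ), IsNewformOf W f ∧ cuspCoeff f p = ap ∧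
            (∀ n : ℕ, 1 ≤ n → ∀ a : (ZMod (p ^ n))ˣ, ‖((teichOrbitSum f p n (a : ZMod (p ^ n)) : ℚ) : ℚ_[p])‖ < 1) ∧
            ∃ i : ℕ, 0 < i ∧ i < p - 1 ∧ Even i ∧
              ∃ k : ℕ, ‖PowerSeries.coeff k (padicLFunctionPlusBranchMult f (ap : ℚ_[p]) i)‖ = 1 :=
  fun _ _ _ _ _ hX _ _ _ ↦ muAnZeroAt_or_exists_even_pos_branch hMz h18 hX

end ClassX11a

end Summit.BirchSwinnertonDyer.BirchSwinnertonDyer.Theorems.X11aLowerHalfBranch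

end
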